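import Literature.MathematicalPhysics.QuantumLattice.SlaterWindowReducedDensityMatrix
import Literature.Analysis.Matrix.DetAddDiagonalMinors
import HarnessLib

/-!
# The window reduced density matrix of a Slater determinant as ONE determinant

Topic `MathematicalPhysics/QuantumLattice`, family `hubbard`; continuation of
`SlaterWindowReducedDensityMatrix.lean`, where the reduced density matrix of the Slater state with
one-particle density matrix block `Q` on a window is the alternating sum
`slaterRDM Q s t = [#s = #t] Σ_{T ⊆ (s ∪ t)ᶜ} (-1)^{|T|} det [Q_{(t⧺T)_l,(s⧺T)_k}]`.
Here the sum over `T` is carried out: with `R = (s ∪ t)ᶜ` and the increasing enumerations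
`s⧺R`, `t⧺R` (of `s` then `R`, resp. `t` then `R`),

  `slaterRDM Q s t = det M`,  `M_{kl} = Q_{(t⧺R)_l,(s⧺R)_k}` for `k < #t` (rows of `s`),
                              `M_{kl} = δ_{kl} - Q_{(t⧺R)_l,(s⧺R)_k}` for `k ≥ #t` (rows of `R`)

(`HartreeFock.slaterRDM_eq_det`; the matrix is `HartreeFock.slaterRDMMatrix`). In block form
`M = [[Qᵀ_{s,t}, Qᵀ_{s,R}], [-Qᵀ_{R,t}, 1 - Qᵀ_{R,R}]]` — the "inversion-free" determinant formula
for the matrix elements `⟨·|ρ_W|·⟩` of a quasi-free (Slater) state reduced to a window `W`, which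
makes them computable by ONE determinant of size `#t + #R ≤ |W|` instead of `2^{|R|}` determinants.
The proof is row-multilinearity of the determinant in the rows of `R`
(`Literature.Analysis.Matrix.det_add_diagonal_eq_sum_minors`: `det (N + diag d) = Σ_S (∏_{i∉S} dᵢ) det N_S`)
followed by the identification of the surviving principal minors (those containing all rows of
`s`) with the terms of the alternating sum. Bratteli–Robinson II §5.2.4 / Bach–Lieb–Solovej 1994
Thm 2.3 (quasi-free states); the determinant identity is elementary linear algebra. Everything is
proved; the one definition (`slaterRDMMatrix`) has a body; no named facts.
-/

noncomputable section

namespace Literature.MathematicalPhysics.QuantumLattice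

open Matrix Finset

namespace HartreeFock

variable {κ : Type*} [LinearOrder κ] [Fintype κ]

/-- **The block matrix of the window reduced density matrix** (rows: `s` then `R = (s ∪ t)ᶜ`;
columns: `t` then `R`; `Q` transposed; identity minus `Q` on the `R`-rows). [cite: BachLiebSolovej1994, Thm 2.3] -/
def slaterRDMMatrix (Q : Matrix κ κ ℂ) (s t : Finset κ) (h : s.card = t.card) :
    Matrix (Fin (t.card + ((s ∪ t)ᶜ).card)) (Fin (t.card + ((s ∪ t)ᶜ).card)) ℂ :=
  Matrix.of fun k l =>
    if t.card ≤ (k : ℕ) then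
      (if k = l then 1 else 0) -
        Q (Fin.append (t.orderEmbOfFin rfl) (((s ∪ t)ᶜ).orderEmbOfFin rfl) l)
          (Fin.append (s.orderEmbOfFin h) (((s ∪ t)ᶜ).orderEmbOfFin rfl) k)
    else
      Q (Fin.append (t.orderEmbOfFin rfl) (((s ∪ t)ᶜ).orderEmbOfFin rfl) l)
        (Fin.append (s.orderEmbOfFin h) (((s ∪ t)ᶜ).orderEmbOfFin rfl) k)

/-- `Fin.append f g` of two strictly increasing maps with `f < g` pointwise is strictly increasing.
[folklore] -/
theorem strictMono_append {a b : ℕ} {α : Type*} [Preorder α] {f : Fin a → α} {g : Fin b → α}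
    (hf : StrictMono f) (hg : StrictMono g) (hfg : ∀ i j, f i < g j) : StrictMono (Fin.append f g) := by
  intro p q hpq
  have hv := Fin.lt_def.1 hpq
  induction p using Fin.addCases with
  | left i =>
    induction q using Fin.addCases with
    | left j =>
      rw [Fin.append_left, Fin.append_left]
      simp only [Fin.val_castAdd] at hv
      exact hf (Fin.lt_def.2 hv)
    | right j => rw [Fin.append_left, Fin.append_right]; exact hfg i j
  | right i =>
    induction q using Fin.addCases with
    | left j =>
      exfalso
      simp only [Fin.val_natAdd, Fin.val_castAdd] at hv
      omega
    | right j =>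
      rw [Fin.append_right, Fin.append_right]
      simp only [Fin.val_natAdd] at hv
      exact hg (Fin.lt_def.2 (by omega))

/-- **The inversion-free determinant formula for the window reduced density matrix**:
`slaterRDM Q s t = det (slaterRDMMatrix Q s t h)` for `#s = #t`. [cite: BachLiebSolovej1994, Thm 2.3] -/
theorem slaterRDM_eq_det (Q : Matrix κ κ ℂ) (s t : Finset κ) (h : s.card = t.card) :
    slaterRDM Q s t = (slaterRDMMatrix Q s t h).det := by
  -- notation
  set R : Finset κ := (s ∪ t)ᶜ with hRdef
  set k₀ : ℕ := t.card with hk₀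
  set r : ℕ := R.card with hr
  set sE : Fin k₀ → κ := ⇑(s.orderEmbOfFin h) with hsE
  set tE : Fin k₀ → κ := ⇑(t.orderEmbOfFin rfl) with htE
  set RE : Fin r → κ := ⇑(R.orderEmbOfFin rfl) with hRE
  set I : Fin (k₀ + r) → κ := Fin.append sE RE with hI
  set J : Fin (k₀ + r) → κ := Fin.append tE RE with hJ
  set X : Matrix (Fin (k₀ + r)) (Fin (k₀ + r)) ℂ := Matrix.of fun k l => Q (J l) (I k) with hX
  set N : Matrix (Fin (k₀ + r)) (Fin (k₀ + r)) ℂ :=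
    Matrix.of fun k l => if k₀ ≤ (k : ℕ) then -X k l else X k l with hN
  set d : Fin (k₀ + r) → ℂ := fun k => if k₀ ≤ (k : ℕ) then 1 else 0 with hd
  -- the block matrix is `N + diagonal d`
  have hM : slaterRDMMatrix Q s t h = N + diagonal d := by
    ext k l
    simp only [slaterRDMMatrix, hN, hd, hX, Matrix.add_apply, Matrix.of_apply, diagonal_apply]
    split_ifs <;> first | rfl | ring
  rw [hM, Literature.Analysis.Matrix.det_add_diagonal_eq_sum_minors]
  -- the weight `∏_{i ∉ S} d i` selects the sets `S` containing all rows `k < k₀`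
  set A : Finset (Fin (k₀ + r)) := univ.map (Fin.castAddEmb r) with hA
  have hmemA : ∀ k : Fin (k₀ + r), k ∈ A ↔ (k : ℕ) < k₀ := by
    intro k
    rw [hA, Finset.mem_map]
    constructor
    · rintro ⟨i, -, rfl⟩; exact i.isLt
    · intro hk; exact ⟨⟨k, hk⟩, mem_univ _, Fin.ext rfl⟩
  have hweight : ∀ S : Finset (Fin (k₀ + r)), (∏ i ∈ Sᶜ, d i) = if A ⊆ S then 1 else 0 := by
    intro S
    simp only [hd]
    rw [Finset.prod_boole]
    by_cases hAS : A ⊆ S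
    · rw [if_pos hAS, if_pos]
      intro k hk
      rw [mem_compl] at hk
      by_contra hlt
      exact hk (hAS ((hmemA k).2 (by omega)))
    · rw [if_neg hAS, if_neg]
      intro hall
      apply hAS
      intro k hk
      by_contra hkS
      have := hall k (mem_compl.2 hkS)
      rw [hmemA] at hk
      omega
  rw [Finset.sum_congr rfl fun S _ => by rw [hweight S, boole_mul], ← Finset.sum_filter]
  -- reindex the surviving sets `S = A ∪ T'` by the subsets `T ⊆ R`
  -- for `T ⊆ R`: its positions inside `R`
  let pos : Finset κ → Finset (Fin r) := fun T => univ.filter fun j => RE j ∈ T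
  let SofT : Finset κ → Finset (Fin (k₀ + r)) := fun T => A ∪ (pos T).map (Fin.natAddEmb k₀)
  let TofS : Finset (Fin (k₀ + r)) → Finset κ := fun S => (univ.filter fun j : Fin r => Fin.natAdd k₀ j ∈ S).map
    ⟨RE, (R.orderEmbOfFin rfl).injective⟩
  rw [slaterRDM, dif_pos h]
  refine Finset.sum_nbij' SofT TofS (fun T hT => ?_) (fun S hS => ?_) (fun T hT => ?_) (fun S hS => ?_)
    (fun T hT => ?_)
  · -- `SofT T` contains `A`
    exact mem_filter.2 ⟨mem_univ _, subset_union_left⟩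
  · -- `TofS S ⊆ R`
    rw [mem_powerset]
    intro x hx
    obtain ⟨j, -, rfl⟩ := Finset.mem_map.1 hx
    exact Finset.orderEmbOfFin_mem R rfl j
  · -- `TofS (SofT T) = T` for `T ⊆ R`
    rw [mem_powerset] at hT
    ext x
    constructor
    · intro hx
      obtain ⟨j, hj, rfl⟩ := Finset.mem_map.1 hx
      rw [mem_filter] at hj
      have hj' := hj.2
      rcases Finset.mem_union.1 hj' with hjA | hjT
      · rw [hmemA] at hjA; simp at hjA
      · obtain ⟨j', hj'T, hjj'⟩ := Finset.mem_map.1 hjT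
        have : j' = j := by
          have := congrArg Fin.val hjj'
          simp [Fin.natAddEmb] at this
          exact Fin.ext this
        subst this
        exact (mem_filter.1 hj'T).2
    · intro hxT
      have hxR : x ∈ R := hT hxT
      obtain ⟨j, hj⟩ : ∃ j : Fin r, RE j = x := by
        have : x ∈ Set.range (R.orderEmbOfFin rfl) := by rw [range_orderEmbOfFin]; exact hxR
        exact this
      refine Finset.mem_map.2 ⟨j, mem_filter.2 ⟨mem_univ _, ?_⟩, hj⟩
      exact Finset.mem_union_right _ (Finset.mem_map.2 ⟨j, mem_filter.2 ⟨mem_univ _, hj ▸ hxT⟩, rfl⟩)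
  · -- `SofT (TofS S) = S` for `A ⊆ S`
    have hAS : A ⊆ S := (mem_filter.1 hS).2
    ext k
    constructor
    · intro hk
      rcases Finset.mem_union.1 hk with hkA | hkT
      · exact hAS hkA
      · obtain ⟨j, hj, rfl⟩ := Finset.mem_map.1 hkT
        rw [mem_filter] at hj
        obtain ⟨x, hx, hxj⟩ := Finset.mem_map.1 hj.2
        have : x = j := (R.orderEmbOfFin rfl).injective hxj
        subst this
        exact (mem_filter.1 hx).2
    · intro hk
      by_cases hlt : (k : ℕ) < k₀
      · exact Finset.mem_union_left _ ((hmemA k).2 hlt)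
      · have hk' : ∃ j : Fin r, Fin.natAdd k₀ j = k := ⟨⟨k - k₀, by omega⟩, Fin.ext (by simp; omega)⟩
        obtain ⟨j, rfl⟩ := hk'
        refine Finset.mem_union_right _ (Finset.mem_map.2 ⟨j, mem_filter.2 ⟨mem_univ _, ?_⟩, rfl⟩)
        exact Finset.mem_map.2 ⟨j, mem_filter.2 ⟨mem_univ _, hk⟩, rfl⟩
  · -- the value: `(-1)^{|T|} det (term T) = det N[SofT T]`
    rw [mem_powerset] at hT
    -- the positions of `T` in `R` enumerate `T`
    have hcardpos : (pos T).card = T.card := by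
      rw [← Finset.card_map ⟨RE, (R.orderEmbOfFin rfl).injective⟩]
      congr 1
      ext x
      constructor
      · intro hx
        obtain ⟨j, hj, rfl⟩ := Finset.mem_map.1 hx
        exact (mem_filter.1 hj).2
      · intro hxT
        obtain ⟨j, hj⟩ : ∃ j : Fin r, RE j = x := by
          have : x ∈ Set.range (R.orderEmbOfFin rfl) := by rw [range_orderEmbOfFin]; exact hT hxT
          exact this
        exact Finset.mem_map.2 ⟨j, mem_filter.2 ⟨mem_univ _, hj ▸ hxT⟩, hj⟩
    set ι : Fin T.card → Fin r := ⇑((pos T).orderEmbOfFin hcardpos) with hι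
    have hιT : (fun j => RE (ι j)) = T.orderEmbOfFin rfl := by
      refine Finset.orderEmbOfFin_unique rfl (fun j => ?_) ?_
      · have := Finset.orderEmbOfFin_mem (pos T) hcardpos j
        exact (mem_filter.1 this).2
      · exact (R.orderEmbOfFin rfl).strictMono.comp ((pos T).orderEmbOfFin hcardpos).strictMono
    -- the enumeration of `SofT T`
    have hcardS : (SofT T).card = k₀ + T.card := by
      rw [Finset.card_union_of_disjoint, hA, Finset.card_map, Finset.card_map, Finset.card_univ,
        Fintype.card_fin, hcardpos]
      rw [Finset.disjoint_left]
      intro k hkA hkT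
      obtain ⟨j, -, rfl⟩ := Finset.mem_map.1 hkT
      rw [hmemA] at hkA
      simp [Fin.natAddEmb] at hkA
    set g : Fin (k₀ + T.card) → Fin (k₀ + r) := Fin.append (Fin.castAdd r) (fun j => Fin.natAdd k₀ (ι j)) with hg
    have hgmono : StrictMono g :=
      strictMono_append (Fin.strictMono_castAdd r) ((Fin.strictMono_natAdd k₀).comp
        ((pos T).orderEmbOfFin hcardpos).strictMono) fun i j => by
          rw [Fin.lt_def]; simp only [Fin.val_castAdd, Fin.val_natAdd]; omega
    have hgmem : ∀ x, g x ∈ SofT T := by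
      intro x
      induction x using Fin.addCases with
      | left i => rw [hg, Fin.append_left]; exact Finset.mem_union_left _ ((hmemA _).2 i.isLt)
      | right j =>
        rw [hg, Fin.append_right]
        exact Finset.mem_union_right _ (Finset.mem_map.2 ⟨ι j, Finset.orderEmbOfFin_mem _ hcardpos j, rfl⟩)
    have hgE : g = (SofT T).orderEmbOfFin hcardS := Finset.orderEmbOfFin_unique hcardS hgmem hgmono
    -- the principal minor on `SofT T`, reindexed by `g`
    have hminor : ((N.submatrix ((↑) : ↥(SofT T) → Fin (k₀ + r)) ((↑) : ↥(SofT T) → Fin (k₀ + r))).det) =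
        (N.submatrix g g).det := by
      rw [← Matrix.det_submatrix_equiv_self ((SofT T).orderIsoOfFin hcardS).toEquiv]
      congr 1
      ext p q
      simp only [submatrix_apply, hgE]
      rfl
    -- `N.submatrix g g = diag(ε) * term(T)`
    have hrow : ∀ p : Fin (k₀ + T.card), (k₀ ≤ ((g p : Fin (k₀ + r)) : ℕ)) ↔ k₀ ≤ (p : ℕ) := by
      intro p
      induction p using Fin.addCases with
      | left i => simp [hg]
      | right j => simp [hg]
    have hIg : ∀ p, I (g p) = Fin.append sE (T.orderEmbOfFin rfl) p := by
      intro p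
      induction p using Fin.addCases with
      | left i => rw [hg, Fin.append_left, hI, Fin.append_left, Fin.append_left]
      | right j => rw [hg, Fin.append_right, hI, Fin.append_right, Fin.append_right, ← hιT]
    have hJg : ∀ p, J (g p) = Fin.append tE (T.orderEmbOfFin rfl) p := by
      intro p
      induction p using Fin.addCases with
      | left i => rw [hg, Fin.append_left, hJ, Fin.append_left, Fin.append_left]
      | right j => rw [hg, Fin.append_right, hJ, Fin.append_right, Fin.append_right, ← hιT]
    have hsub : N.submatrix g g =
        diagonal (fun p : Fin (k₀ + T.card) => if k₀ ≤ (p : ℕ) then (-1 : ℂ) else 1) *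
          Matrix.of fun p q => Q (Fin.append tE (T.orderEmbOfFin rfl) q) (Fin.append sE (T.orderEmbOfFin rfl) p) := by
      ext p q
      simp only [diagonal_mul, submatrix_apply, hN, hX, Matrix.of_apply, hIg, hJg]
      by_cases hp : k₀ ≤ (p : ℕ)
      · rw [if_pos ((hrow p).2 hp), if_pos hp, neg_one_mul]
      · rw [if_neg (fun h' => hp ((hrow p).1 h')), if_neg hp, one_mul]
    have hsign : (diagonal (fun p : Fin (k₀ + T.card) => if k₀ ≤ (p : ℕ) then (-1 : ℂ) else 1)).det =
        (-1) ^ T.card := by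
      rw [det_diagonal, Fin.prod_univ_add]
      have h1 : ∏ i : Fin k₀, (if k₀ ≤ ((Fin.castAdd T.card i : Fin (k₀ + T.card)) : ℕ) then (-1 : ℂ) else 1) = 1 :=
        Finset.prod_eq_one fun i _ => by simp
      have h2 : ∏ j : Fin T.card, (if k₀ ≤ ((Fin.natAdd k₀ j : Fin (k₀ + T.card)) : ℕ) then (-1 : ℂ) else 1) =
          (-1) ^ T.card := by simp
      rw [h1, h2, one_mul]
    rw [hminor, hsub, det_mul, hsign]

end HartreeFock

end Literature.MathematicalPhysics.QuantumLattice
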